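import Literature.Analysis.FluidPDE.TaoAveragedScaleFormsAt
import Literature.Analysis.FluidPDE.TaoSingleScaleGeometryAt
import Literature.Analysis.FluidPDE.TaoCascadeOfSingleScale
import HarnessLib

/-!
# Tao 2016, §3.4 about a GENERAL base triple: the cascade operator from its single-scale piece,
# without dilation operators

T. Tao, *Finite time blowup for an averaged three-dimensional Navier–Stokes equation*,
J. Amer. Math. Soc. **29** (2016), 601–674 = arXiv:1402.0290v3, §3.4 "Fourth step: localising to a
single frequency scale", pp. 16–17. Sequel of `TaoCascadeOfSingleScale.lean`, which proves the step
at Tao's normalisation (3.7): **if `C₀` (3.8) is a dilation-free complex average (3.9) of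
`B_{η,ρ,0}`, then the complexified basic cascade operator `C` (3.6) is a complex average of
`B_{η,ρ}`**. Here the base triple `ξ` (moduli in `[1/2, 2]`) is a parameter: the profiles are
normalised about `ξ` (`NormalisedProfilesAt`), the targets are `B_{η,ρ,0;ξ}` (`betaRhoZeroFormAt`,
`TaoAveragedSingleScaleAt.lean`) and `B_{η,ρ;ξ}` (`betaRhoFormAt`, `TaoAveragedScaleFormsAt.lean`),
and the resulting average is DILATION-FREE (the single-scale datum keeps `λ ≡ 1`). HONEST FRAMING
(cell harvest/h2-tao-ladder, TAO-LADDER rung M_1 — MODEL statements about Tao's averaged equation):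
the printed §3.4 argument re-run with `ξ⁰ ↦ ξ` (Remark 3.5), for the rung-1 support item
`CascadeNoDilOfSingleScaleAt`; nothing here concerns the true Navier–Stokes equations.

The printed argument (p. 17) and its rendering, exactly as in `TaoCascadeOfSingleScale.lean`:
1. smooth localisation of each `m_{j,ω}` to `B(ξⱼ, O(ε₀³))` — radial cut-offs
   `χⱼ = shellCutoff |ξ j| (5ε₀³)` (`slotCutoffAt`; width `5ε₀³` so that `χⱼ = 1` on `B(ξ j, ε₀³)`
   also when `|ξ j| = 2`), invisible to `C₀` (`singleScaleForm_fourierMultiplierAt`);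
2. `m̃_{i,ω} = Σₙ (m_{i,ω}χᵢ)((1+ε₀)^{-n} ·)` (`localisedSymbolAt`, order `0`, (3.5) survives) and the
   datum `ComplexAveragingDatum.singleScaleAt` (same `(Ω, μ)`, same rotations, NO dilations);
3. `⟨C_n(u,v),w⟩ = ∫_Ω ⟨B_{η,ρ,n;ξ}(A'_1u, A'_2v), A'_3w⟩ dμ` (`cascadeTerm_eq_integral_singleScaleAt`):
   the two scaling laws, (3.9) at dilated truncated fields, the vanishing of the cross terms
   (`weightedForm_slot_localiseAt`: the weight of `B_{η,ρ,0;ξ}` confines `ζⱼ` to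
   `| |ζⱼ| - |ξ j| | < 60ε₀²`, where `m̃ⱼ = mⱼχⱼ`), commutation with the dilations;
4. summation over `n` (`cplxBasicCascadeForm_eq_averageAt`) and the dilation-free conclusion
   **`cascade_of_singleScaleAt_noDil`** (threshold `ε₀ ≤ 1/1000`, base moduli in `[1/2, 2]`).

## References

* T. Tao, J. Amer. Math. Soc. 29 (2016), 601–674, arXiv:1402.0290v3, §3.4 pp. 16–17 ((3.6)–(3.9)),
  Def. 3.4 p. 15, Remark 3.5 p. 20. Key `Tao2016AveragedNS`.
-/

noncomputable section

open MeasureTheory Set Filter FourierTransform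
open scoped ENNReal NNReal SchwartzMap ComplexConjugate

namespace Literature.Analysis.FluidPDE.Tao2016

/-- Local notation for physical / frequency space `ℝ³`. -/
local notation "ℝ³" => EuclideanSpace ℝ (Fin 3)
/-- Local notation for the complexified range `ℂ³`. -/
local notation "ℂ³" => EuclideanSpace ℂ (Fin 3)

variable {ξ : Fin 3 → ℝ³}

/-! ### Bookkeeping for the weights of `B_{η,ρ,n;ξ}` -/

/-- `0 ≤ weightₙ`. [cite: Tao2016AveragedNS, §3.4 p. 16] -/
theorem scaleWeightAt_nonneg (ξ : Fin 3 → ℝ³) (ε₀ : ℝ) (n : ℤ) (p : ℝ³ × ℝ³) :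
    0 ≤ scaleWeightAt ξ ε₀ n p :=
  mul_nonneg (freqCutoff_nonneg _) (etaAt_nonneg _ _ _ _ _)

/-- `weightₙ ≤ 1`. [cite: Tao2016AveragedNS, §3.4 p. 16] -/
theorem scaleWeightAt_le_one (ξ : Fin 3 → ℝ³) (ε₀ : ℝ) (n : ℤ) (p : ℝ³ × ℝ³) :
    scaleWeightAt ξ ε₀ n p ≤ 1 :=
  mul_le_one₀ (freqCutoff_le_one _) (etaAt_nonneg _ _ _ _ _) (etaAt_le_one _ _ _ _ _)

/-- `‖weightₙ‖ₑ ≤ 1`. [cite: Tao2016AveragedNS, §3.4 p. 16] -/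
theorem enorm_scaleWeightAt_le_one (ξ : Fin 3 → ℝ³) (ε₀ : ℝ) (n : ℤ) (p : ℝ³ × ℝ³) :
    ‖scaleWeightAt ξ ε₀ n p‖ₑ ≤ 1 := by
  rw [Real.enorm_eq_ofReal (scaleWeightAt_nonneg ξ ε₀ n p)]
  exact ENNReal.ofReal_le_one.2 (scaleWeightAt_le_one ξ ε₀ n p)

/-- The weights of `B_{η,ρ,n;ξ}` are measurable. [cite: Tao2016AveragedNS, §3.4 p. 16] -/
theorem measurable_scaleWeightAt (ξ : Fin 3 → ℝ³) (ε₀ : ℝ) (n : ℤ) :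
    Measurable (scaleWeightAt ξ ε₀ n) := by
  have hφ : Measurable freqCutoff := (contDiff_freqCutoff (n := 0)).continuous.measurable
  have h1 : Measurable fun p : ℝ³ × ℝ³ => ((1 + ε₀) ^ (-n) : ℝ) • p.1 - ξ 0 :=
    (measurable_fst.const_smul ((1 + ε₀) ^ (-n) : ℝ)).sub measurable_const
  have h2 : Measurable fun p : ℝ³ × ℝ³ => ‖((1 + ε₀) ^ (-n) : ℝ) • p.1 - ξ 0‖ / ε₀ ^ 2 :=
    h1.norm.div measurable_const
  unfold scaleWeightAt
  exact (hφ.comp h2).mul (measurable_etaAt_norm ξ ε₀)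

/-- **At most one scale**: if both `weightₙ` and `weightₙ'` are non-zero at a frequency pair then
`n = n'` (base modulus `|ξ 0| ≥ 1/2`, `0 < ε₀ ≤ 1/10`). [cite: Tao2016AveragedNS, §3.3–3.4 p. 16] -/
theorem scaleWeightAt_ne_zero_unique (hξ : ∀ j, 1 / 2 ≤ ‖ξ j‖ ∧ ‖ξ j‖ ≤ 2) {ε₀ : ℝ} (hε : 0 < ε₀)
    (hε10 : ε₀ ≤ 1 / 10) {n n' : ℤ} {p : ℝ³ × ℝ³} (hn : scaleWeightAt ξ ε₀ n p ≠ 0)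
    (hn' : scaleWeightAt ξ ε₀ n' p ≠ 0) : n = n' :=
  scaleFactorAt_ne_zero_unique hε hε10 (hξ 0).1 (left_ne_zero_of_mul hn) (left_ne_zero_of_mul hn')

/-- **`Σₙ |weightₙ| ≤ 1` pointwise** (at most one non-zero summand, each in `[0,1]`).
[cite: Tao2016AveragedNS, §3.4 p. 16] -/
theorem tsum_enorm_scaleWeightAt_le_one (hξ : ∀ j, 1 / 2 ≤ ‖ξ j‖ ∧ ‖ξ j‖ ≤ 2) {ε₀ : ℝ}
    (hε : 0 < ε₀) (hε10 : ε₀ ≤ 1 / 10) (p : ℝ³ × ℝ³) :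
    ∑' n : ℤ, ‖scaleWeightAt ξ ε₀ n p‖ₑ ≤ 1 := by
  by_cases h : ∃ n : ℤ, scaleWeightAt ξ ε₀ n p ≠ 0
  · obtain ⟨n₀, hn₀⟩ := h
    rw [tsum_eq_single n₀]
    · exact enorm_scaleWeightAt_le_one ξ ε₀ n₀ p
    · intro n hn
      have : scaleWeightAt ξ ε₀ n p = 0 := by
        by_contra h'
        exact hn (scaleWeightAt_ne_zero_unique hξ hε hε10 h' hn₀)
      rw [this, enorm_zero]
  · simp only [not_exists, not_not] at h
    simp [h]

/-- **Where the weight of `B_{η,ρ,0;ξ}` lives**: the three frequencies lie in the shells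
`| |ζⱼ| - |ξ j| | < 60ε₀²`. [cite: Tao2016AveragedNS, §3.3–3.4 pp. 16–17] -/
theorem scaleWeightAt_zero_regions (hξ : ∀ j, 1 / 2 ≤ ‖ξ j‖ ∧ ‖ξ j‖ ≤ 2) {ε₀ : ℝ} (hε : 0 < ε₀)
    (hε10 : ε₀ ≤ 1 / 10) {p : ℝ³ × ℝ³} (h : scaleWeightAt ξ ε₀ 0 p ≠ 0) :
    p.1 ∈ normShell ‖ξ 0‖ (60 * ε₀ ^ 2) ∧ p.2 ∈ normShell ‖ξ 1‖ (60 * ε₀ ^ 2) ∧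
      -p.1 - p.2 ∈ normShell ‖ξ 2‖ (60 * ε₀ ^ 2) := by
  refine singleScaleWeightAt_zero_regions hξ hε hε10 ?_
  simpa [scaleWeightAt] using h

/-- **`C₀` does not see Fourier projections equal to `1` on the balls carrying the `ψ̂ⱼ`** (§3.4,
"we may smoothly localise each `m_{j,ω}` … without loss of generality"), for profiles normalised about
arbitrary centres `c j`. [cite: Tao2016AveragedNS, §3.4 p. 17] -/
theorem singleScaleForm_fourierMultiplierAt {c : Fin 3 → ℝ³} {r : ℝ} {ψ : Fin 3 → 𝓢(ℝ³, ℂ³)}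
    (hψ : ∀ j, HasBallFourierSupport (c j) r (ψ j)) (m : Fin 3 → Lp ℂ ∞ (volume : Measure ℝ³))
    (hm : ∀ j, ∀ᵐ ζ ∂(volume : Measure ℝ³), ζ ∈ Metric.closedBall (c j) r → (m j : ℝ³ → ℂ) ζ = 1)
    (u v w : L2C) :
    singleScaleForm (ψ 0) (ψ 1) (ψ 2) (fourierMultiplier (m 0) u) (fourierMultiplier (m 1) v)
        (fourierMultiplier (m 2) w) =
      singleScaleForm (ψ 0) (ψ 1) (ψ 2) u v w := by
  simp only [singleScaleForm,
    pairing_fourierMultiplier_conjL2 (isBandLimited_toLp_of_hasBallFourierSupport (hψ 0)) (m 0) (hm 0),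
    pairing_fourierMultiplier_conjL2 (isBandLimited_toLp_of_hasBallFourierSupport (hψ 1)) (m 1) (hm 1),
    pairing_fourierMultiplier_conjL2 (isBandLimited_toLp_of_hasBallFourierSupport (hψ 2)) (m 2) (hm 2)]

/-! ### The localised, periodised symbols `m̃` about `ξ` -/

/-- The radial cut-off of slot `i` about `ξ`: `χᵢ = χ_{|ξ i|, 5ε₀³}`, equal to `1` on `B(ξ i, ε₀³)` and
supported in the shell `{| |ζ|² - |ξ i|² | < 10ε₀³}`. [cite: Tao2016AveragedNS, §3.4 p. 17] -/
def slotCutoffAt (ξ : Fin 3 → ℝ³) (ε₀ : ℝ) (i : Fin 3) (ζ : ℝ³) : ℂ :=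
  shellCutoff ‖ξ i‖ (5 * ε₀ ^ 3) ζ

/-- **Tao's `m̃_{i,ω} = Σₙ m_{i,ω,n}` for the symbol localised about `ξ i`**:
`m ↦ Σₙ (m χᵢ)((1+ε₀)^{-n} ·)`. [cite: Tao2016AveragedNS, §3.4 p. 17] -/
def localisedSymbolAt (ξ : Fin 3 → ℝ³) (ε₀ : ℝ) (i : Fin 3) (m : ℝ³ → ℂ) : ℝ³ → ℂ :=
  periodise (1 + ε₀) (fun ζ => m ζ * slotCutoffAt ξ ε₀ i ζ)

/-- The cut-off of slot `i` is a complex order-`0` symbol. [cite: Tao2016AveragedNS, §3.4 p. 17] -/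
theorem isComplexSymbol_slotCutoffAt (ξ : Fin 3 → ℝ³) {ε₀ : ℝ} (hε : 0 < ε₀) (i : Fin 3) :
    IsComplexSymbol (slotCutoffAt ξ ε₀ i) :=
  isComplexSymbol_shellCutoff _ (by positivity)

/-- The cut-off symbol `m χᵢ` is supported in the admissible shell of slot `i`. [cite: Tao2016AveragedNS, §3.4 p. 17] -/
theorem isShellSupported_mul_slotCutoffAt (ξ : Fin 3 → ℝ³) {ε₀ : ℝ} (hε : 0 < ε₀) (i : Fin 3)
    (m : ℝ³ → ℂ) :
    IsShellSupported (‖ξ i‖ ^ 2 - 10 * ε₀ ^ 3) (‖ξ i‖ ^ 2 + 10 * ε₀ ^ 3)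
      (fun ζ => m ζ * slotCutoffAt ξ ε₀ i ζ) :=
  isShellSupported_mul_shellCutoff_five m _ hε

/-- **The localised symbols are complex Fourier multipliers of order `0`** ("then the `m̃_{i,ω}(D)`
are also Fourier multipliers of order `0`", §3.4). [cite: Tao2016AveragedNS, §3.4 p. 17] -/
theorem isComplexSymbol_localisedSymbolAt (hξ : ∀ j, 1 / 2 ≤ ‖ξ j‖ ∧ ‖ξ j‖ ≤ 2) {ε₀ : ℝ}
    (hε : 0 < ε₀) (hε10 : ε₀ ≤ 1 / 10) (i : Fin 3) {m : ℝ³ → ℂ} (hm : IsComplexSymbol m) :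
    IsComplexSymbol (localisedSymbolAt ξ ε₀ i m) :=
  IsComplexSymbol.periodise (one_lt_base hε) (localShellAt_pos (hξ i).1 hε hε10)
    (localShellAt_lt (hξ i).1 hε hε10) (isShellSupported_mul_slotCutoffAt ξ hε i m)
    (hm.mul (isComplexSymbol_slotCutoffAt ξ hε i))

/-- **Seminorm bound for the localised symbols**:
`‖m̃‖_k ≤ ‖m χᵢ‖_k ≤ Σ_{j ≤ k} (k choose j) ‖m‖_j ‖χᵢ‖_{k-j}`. [cite: Tao2016AveragedNS, §3.2 p. 16 and §3.4 p. 17] -/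
theorem symbolSeminorm_localisedSymbolAt_le (hξ : ∀ j, 1 / 2 ≤ ‖ξ j‖ ∧ ‖ξ j‖ ≤ 2) {ε₀ : ℝ}
    (hε : 0 < ε₀) (hε10 : ε₀ ≤ 1 / 10) (i : Fin 3) {m : ℝ³ → ℂ} (hm : IsComplexSymbol m) (k : ℕ) :
    symbolSeminorm k (localisedSymbolAt ξ ε₀ i m) ≤
      ∑ j ∈ Finset.range (k + 1), (k.choose j : ℝ≥0∞) *
        (symbolSeminorm j m * symbolSeminorm (k - j) (slotCutoffAt ξ ε₀ i)) :=
  (symbolSeminorm_periodise_le (one_lt_base hε) (localShellAt_pos (hξ i).1 hε hε10)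
    (localShellAt_lt (hξ i).1 hε hε10) (isShellSupported_mul_slotCutoffAt ξ hε i m)
    (hm.mul (isComplexSymbol_slotCutoffAt ξ hε i)).1 k).trans
    (symbolSeminorm_mul_le hm.1 (isComplexSymbol_slotCutoffAt ξ hε i).1 k)

/-- The localised symbols of a measurable family are measurable (off the origin). [cite: Tao2016AveragedNS, §3.4 p. 17] -/
theorem measurable_localisedSymbolAt {Ω : Type*} [MeasurableSpace Ω]
    (hξ : ∀ j, 1 / 2 ≤ ‖ξ j‖ ∧ ‖ξ j‖ ≤ 2) {ε₀ : ℝ} (hε : 0 < ε₀) (hε10 : ε₀ ≤ 1 / 10) (i : Fin 3)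
    {m : Ω → ℝ³ → ℂ} (hmeas : ∀ ζ : ℝ³, ζ ≠ 0 → Measurable fun θ => m θ ζ) {ζ : ℝ³} (hζ : ζ ≠ 0) :
    Measurable fun θ => localisedSymbolAt ξ ε₀ i (m θ) ζ :=
  measurable_periodise (one_lt_base hε) (localShellAt_pos (hξ i).1 hε hε10)
    (localShellAt_lt (hξ i).1 hε hε10) (fun θ => isShellSupported_mul_slotCutoffAt ξ hε i (m θ))
    (fun ζ hζ => (hmeas ζ hζ).mul measurable_const) hζ

/-- **Multiplicative periodicity of `m̃`**: `m̃((1+ε₀)ⁿ ζ) = m̃(ζ)`. [cite: Tao2016AveragedNS, §3.4 p. 17] -/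
theorem localisedSymbolAt_zpow_smul (ξ : Fin 3 → ℝ³) {ε₀ : ℝ} (hε : 0 < ε₀) (i : Fin 3)
    (m : ℝ³ → ℂ) (n : ℤ) (ζ : ℝ³) :
    localisedSymbolAt ξ ε₀ i m ((1 + ε₀) ^ n • ζ) = localisedSymbolAt ξ ε₀ i m ζ :=
  periodise_zpow_smul (by linarith : (1 + ε₀) ≠ 0) _ n ζ

/-- **On the thin shell `| |ζ| - |ξ i| | < 60ε₀²` the localised symbol is `m χᵢ`** (`0 < ε₀ ≤ 1/1000`,
moduli in `[1/2, 2]`: the shell lies in the fundamental scale shell). [cite: Tao2016AveragedNS, §3.4 p. 17] -/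
theorem localisedSymbolAt_eq_of_mem_normShell (hξ : ∀ j, 1 / 2 ≤ ‖ξ j‖ ∧ ‖ξ j‖ ≤ 2) {ε₀ : ℝ}
    (hε : 0 < ε₀) (hε1 : ε₀ ≤ 1 / 1000) (i : Fin 3) (m : ℝ³ → ℂ) {ζ : ℝ³}
    (hζ : ζ ∈ normShell ‖ξ i‖ (60 * ε₀ ^ 2)) :
    localisedSymbolAt ξ ε₀ i m ζ = m ζ * slotCutoffAt ξ ε₀ i ζ := by
  obtain ⟨h1, h2⟩ := normShell_subset_fundamentalAt (hξ i).1 (hξ i).2 hε hε1 hζ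
  exact periodise_eq_self (one_lt_base hε) (isShellSupported_mul_slotCutoffAt ξ hε i m) h1 h2

/-- The slot cut-off is radial. [cite: Tao2016AveragedNS, §3.4 p. 17] -/
theorem slotCutoffAt_linearIsometryEquiv (ξ : Fin 3 → ℝ³) (ε₀ : ℝ) (i : Fin 3)
    (R : ℝ³ ≃ₗᵢ[ℝ] ℝ³) (ζ : ℝ³) : slotCutoffAt ξ ε₀ i (R ζ) = slotCutoffAt ξ ε₀ i ζ :=
  shellCutoff_linearIsometryEquiv _ _ R ζ

/-- The slot cut-off equals `1` on the ball `B(ξ i, ε₀³)` carrying `ψ̂ᵢ` (`|ξ i| ≤ 2`, `0 < ε₀ ≤ 1`).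
[cite: Tao2016AveragedNS, §3.4 p. 17] -/
theorem slotCutoffAt_eq_one (hξ : ∀ j, 1 / 2 ≤ ‖ξ j‖ ∧ ‖ξ j‖ ≤ 2) {ε₀ : ℝ} (hε : 0 < ε₀)
    (hε1 : ε₀ ≤ 1) (i : Fin 3) {ζ : ℝ³} (hζ : ζ ∈ Metric.closedBall (ξ i) (ε₀ ^ 3)) :
    slotCutoffAt ξ ε₀ i ζ = 1 :=
  shellCutoff_five_eq_one_of_mem_closedBall (norm_nonneg _) (hξ i).2 hε hε1 rfl hζ

/-- The `L^∞` class of the slot cut-off, `χᵢ(D)` being the corresponding Fourier projection.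
[cite: Tao2016AveragedNS, §3.4 p. 17] -/
def slotCutoffAtLp (ξ : Fin 3 → ℝ³) {ε₀ : ℝ} (hε : 0 < ε₀) (i : Fin 3) :
    Lp ℂ ∞ (volume : Measure ℝ³) :=
  ((isComplexSymbol_shellCutoff ‖ξ i‖ (by positivity : (0 : ℝ) < 5 * ε₀ ^ 3)).memLp_top).toLp
    (slotCutoffAt ξ ε₀ i)

/-- `slotCutoffAtLp = slotCutoffAt` a.e. [folklore] -/
private theorem coeFn_slotCutoffAtLp (ξ : Fin 3 → ℝ³) {ε₀ : ℝ} (hε : 0 < ε₀) (i : Fin 3) :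
    (slotCutoffAtLp ξ hε i : ℝ³ → ℂ) =ᵐ[volume] slotCutoffAt ξ ε₀ i :=
  MemLp.coeFn_toLp _

/-- `slotCutoffAtLp = 1` a.e. on the ball `B(ξ i, ε₀³)`. [cite: Tao2016AveragedNS, §3.4 p. 17] -/
theorem slotCutoffAtLp_eq_one_on_ball (hξ : ∀ j, 1 / 2 ≤ ‖ξ j‖ ∧ ‖ξ j‖ ≤ 2) {ε₀ : ℝ} (hε : 0 < ε₀)
    (hε1 : ε₀ ≤ 1) (i : Fin 3) :
    ∀ᵐ ζ ∂(volume : Measure ℝ³), ζ ∈ Metric.closedBall (ξ i) (ε₀ ^ 3) →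
      (slotCutoffAtLp ξ hε i : ℝ³ → ℂ) ζ = 1 := by
  filter_upwards [coeFn_slotCutoffAtLp ξ hε i] with ζ hζ hmem
  rw [hζ]
  exact slotCutoffAt_eq_one hξ hε hε1 i hmem

/-! ### The single-scale datum about `ξ`: same `(Ω, μ)`, same rotations, no dilations, symbols `m̃` -/

namespace ComplexAveragingDatum

variable (𝒟 : ComplexAveragingDatum)

/-- The constants of the Leibniz bound for slot `i`: `(k choose j) ‖χᵢ‖_{k-j}` (finite).
[cite: Tao2016AveragedNS, §3.4 p. 17] -/
def leibnizConstAt (ξ : Fin 3 → ℝ³) (ε₀ : ℝ) (i : Fin 3) (k j : ℕ) : ℝ≥0∞ :=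
  (k.choose j : ℝ≥0∞) * symbolSeminorm (k - j) (slotCutoffAt ξ ε₀ i)

/-- The Leibniz constants are finite. [folklore] -/
private theorem leibnizConstAt_lt_top (ξ : Fin 3 → ℝ³) {ε₀ : ℝ} (hε : 0 < ε₀) (i : Fin 3)
    (k j : ℕ) : leibnizConstAt ξ ε₀ i k j < ∞ :=
  ENNReal.mul_lt_top (by simp) ((isComplexSymbol_slotCutoffAt ξ hε i).2 _)

/-- **The integrability conditions (3.5) survive localisation and periodisation**: for all
`k₁ k₂ k₃`, `∫_Ω ‖m̃₁‖_{k₁} ‖m̃₂‖_{k₂} ‖m̃₃‖_{k₃} dμ < ∞`. [cite: Tao2016AveragedNS, §3.4 p. 17] -/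
theorem lintegral_localisedSymbolAt_lt_top (hξ : ∀ j, 1 / 2 ≤ ‖ξ j‖ ∧ ‖ξ j‖ ≤ 2) {ε₀ : ℝ}
    (hε : 0 < ε₀) (hε10 : ε₀ ≤ 1 / 10) (k : Fin 3 → ℕ) :
    ∫⁻ θ, ∏ i, symbolSeminorm (k i) (localisedSymbolAt ξ ε₀ i (𝒟.m i θ)) ∂𝒟.μ < ∞ := by
  set t : Fin 3 → Finset ℕ := fun i => Finset.range (k i + 1) with ht
  set f : ∀ i : Fin 3, ℕ → 𝒟.Ω → ℝ≥0∞ := fun i j θ =>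
    leibnizConstAt ξ ε₀ i (k i) j * symbolSeminorm j (𝒟.m i θ) with hf
  have hpt : ∀ θ, ∏ i, symbolSeminorm (k i) (localisedSymbolAt ξ ε₀ i (𝒟.m i θ)) ≤
      ∑ x ∈ Fintype.piFinset t, ∏ i, f i (x i) θ := by
    intro θ
    have hexp : ∏ i, ∑ j ∈ t i, f i j θ = ∑ x ∈ Fintype.piFinset t, ∏ i, f i (x i) θ :=
      Finset.prod_univ_sum t (fun i j => f i j θ)
    refine le_trans ?_ (le_of_eq hexp)
    refine Finset.prod_le_prod' fun i _ => ?_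
    refine (symbolSeminorm_localisedSymbolAt_le hξ hε hε10 i (𝒟.isComplexSymbol i θ) (k i)).trans
      (le_of_eq (Finset.sum_congr rfl fun j _ => ?_))
    simp only [hf, leibnizConstAt]
    ring
  have hmeas : ∀ x : Fin 3 → ℕ, Measurable fun θ => ∏ i, f i (x i) θ := fun x =>
    Finset.measurable_prod _ fun i _ => (𝒟.measurable_symbolSeminorm i (x i)).const_mul _
  refine lt_of_le_of_lt (lintegral_mono hpt) ?_
  rw [lintegral_finsetSum _ fun x _ => hmeas x]
  refine ENNReal.sum_lt_top.2 fun x _ => ?_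
  have hsplit : ∀ θ, ∏ i, f i (x i) θ =
      (∏ i, leibnizConstAt ξ ε₀ i (k i) (x i)) * (symbolSeminorm (x 0) (𝒟.m 0 θ) *
        symbolSeminorm (x 1) (𝒟.m 1 θ) * symbolSeminorm (x 2) (𝒟.m 2 θ)) := by
    intro θ
    simp only [hf, Fin.prod_univ_three]
    ring
  simp_rw [hsplit]
  rw [lintegral_const_mul _ (𝒟.measurable_symbolSeminorm_prod (x 0) (x 1) (x 2))]
  refine ENNReal.mul_lt_top (ENNReal.prod_lt_top fun i _ => leibnizConstAt_lt_top ξ hε i _ _) ?_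
  exact 𝒟.moment (x 0) (x 1) (x 2)

/-- **The single-scale datum about `ξ`** (§3.4 with `ξ⁰ ↦ ξ`): the finite measure space and the
rotations of the datum `𝒟` of (3.9), dilation factors `1`, and the localised periodised symbols
`m̃_{i,ω} = Σₙ (m_{i,ω} χᵢ)((1+ε₀)^{-n} ·)` (base moduli in `[1/2, 2]`, `0 < ε₀ ≤ 1/1000`).
[cite: Tao2016AveragedNS, §3.4 p. 17] -/
def singleScaleAt (hξ : ∀ j, 1 / 2 ≤ ‖ξ j‖ ∧ ‖ξ j‖ ≤ 2) {ε₀ : ℝ} (hε : 0 < ε₀)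
    (hε1 : ε₀ ≤ 1 / 1000) : ComplexAveragingDatum where
  Ω := 𝒟.Ω
  μ := 𝒟.μ
  m i θ := localisedSymbolAt ξ ε₀ i (𝒟.m i θ)
  R := 𝒟.R
  lam _ _ := 1
  isComplexSymbol i θ :=
    isComplexSymbol_localisedSymbolAt hξ hε (hε1.trans (by norm_num)) i (𝒟.isComplexSymbol i θ)
  det_R := 𝒟.det_R
  lam_pos _ _ := one_pos
  lam_bdd := ⟨1, fun _ _ => by simp⟩
  moment k₁ k₂ k₃ := by
    have h := 𝒟.lintegral_localisedSymbolAt_lt_top hξ hε (hε1.trans (by norm_num)) ![k₁, k₂, k₃]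
    simpa only [Fin.prod_univ_three, Matrix.cons_val_zero, Matrix.cons_val_one,
      Matrix.cons_val] using h
  measurable_m i ζ hζ :=
    measurable_localisedSymbolAt hξ hε (hε1.trans (by norm_num)) i
      (fun ζ hζ => 𝒟.measurable_m i ζ hζ) hζ
  measurable_R := 𝒟.measurable_R
  measurable_lam _ := measurable_const

section SingleScaleAt

variable {ε₀ : ℝ}

/-- The dilation factors of the single-scale datum are `1`. [cite: Tao2016AveragedNS, §3.4 p. 17] -/
theorem singleScaleAt_lam (hξ : ∀ j, 1 / 2 ≤ ‖ξ j‖ ∧ ‖ξ j‖ ≤ 2) (hε : 0 < ε₀) (hε1 : ε₀ ≤ 1 / 1000)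
    (i : Fin 3) (θ : 𝒟.Ω) : (𝒟.singleScaleAt hξ hε hε1).lam i θ = 1 := rfl

/-- The symbols of the single-scale datum are `L^∞`. [folklore] -/
private theorem memLp_localisedSymbolAt (hξ : ∀ j, 1 / 2 ≤ ‖ξ j‖ ∧ ‖ξ j‖ ≤ 2) (hε : 0 < ε₀)
    (hε1 : ε₀ ≤ 1 / 1000) (i : Fin 3) (θ : 𝒟.Ω) :
    MemLp (localisedSymbolAt ξ ε₀ i (𝒟.m i θ)) ∞ (volume : Measure ℝ³) :=
  ((𝒟.singleScaleAt hξ hε hε1).isComplexSymbol i θ).memLp_top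

/-- **The slots of the single-scale datum**: `A'_{i,ω} = m̃_{i,ω}(D) Rot_{R_{i,ω}}` (no dilation).
[cite: Tao2016AveragedNS, §3.4 p. 17] -/
theorem singleScaleAt_slot (hξ : ∀ j, 1 / 2 ≤ ‖ξ j‖ ∧ ‖ξ j‖ ≤ 2) (hε : 0 < ε₀) (hε1 : ε₀ ≤ 1 / 1000)
    (i : Fin 3) (θ : 𝒟.Ω) (U : L2C) :
    (𝒟.singleScaleAt hξ hε hε1).slot i θ U =
      fourierMultiplier ((𝒟.memLp_localisedSymbolAt hξ hε hε1 i θ).toLp _) (rot (𝒟.R i θ) U) := by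
  show fourierMultiplier _ (rot (𝒟.R i θ) (dil 1 U)) = _
  rw [dil_one]
  rfl

/-- **The Fourier side of the single-scale slots**: `𝓕(A'_{i,ω}U)(ζ) = m̃_{i,ω}(ζ) R_ℂ Û(R⁻¹ζ)` a.e.
[cite: Tao2016AveragedNS, §3.4 p. 17] -/
theorem fourierFn_singleScaleAt_slot (hξ : ∀ j, 1 / 2 ≤ ‖ξ j‖ ∧ ‖ξ j‖ ≤ 2) (hε : 0 < ε₀)
    (hε1 : ε₀ ≤ 1 / 1000) (i : Fin 3) (θ : 𝒟.Ω) (U : L2C) :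
    fourierFn ((𝒟.singleScaleAt hξ hε hε1).slot i θ U) =ᵐ[volume] fun ζ =>
      localisedSymbolAt ξ ε₀ i (𝒟.m i θ) ζ • rotMat (𝒟.R i θ) (fourierFn U ((𝒟.R i θ).symm ζ)) := by
  rw [𝒟.singleScaleAt_slot hξ hε hε1]
  filter_upwards [fourierFn_fourierMultiplier_toLp (𝒟.memLp_localisedSymbolAt hξ hε hε1 i θ)
    (rot (𝒟.R i θ) U), fourierFn_rot (𝒟.R i θ) U] with ζ h1 h2
  rw [h1, h2]

/-- **The single-scale slots commute with the dilations `Dil_{(1+ε₀)^{-n}}`** (periodicity of `m̃`).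
[cite: Tao2016AveragedNS, §3.4 p. 17] -/
theorem singleScaleAt_slot_dil (hξ : ∀ j, 1 / 2 ≤ ‖ξ j‖ ∧ ‖ξ j‖ ≤ 2) (hε : 0 < ε₀)
    (hε1 : ε₀ ≤ 1 / 1000) (i : Fin 3) (θ : 𝒟.Ω) (n : ℤ) (U : L2C) :
    (𝒟.singleScaleAt hξ hε hε1).slot i θ (dil ((1 + ε₀) ^ n)⁻¹ U) =
      dil ((1 + ε₀) ^ n)⁻¹ ((𝒟.singleScaleAt hξ hε hε1).slot i θ U) := by
  have hq : 0 < 1 + ε₀ := by linarith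
  have hc : 0 < ((1 + ε₀) ^ n)⁻¹ := inv_pos.2 (zpow_pos hq n)
  have hm := 𝒟.memLp_localisedSymbolAt hξ hε hε1 i θ
  have hper : (fun ζ => localisedSymbolAt ξ ε₀ i (𝒟.m i θ) ((((1 + ε₀) ^ n)⁻¹)⁻¹ • ζ)) =
      localisedSymbolAt ξ ε₀ i (𝒟.m i θ) := by
    funext ζ
    rw [inv_inv, localisedSymbolAt_zpow_smul ξ hε]
  have hmc : MemLp (fun ζ => localisedSymbolAt ξ ε₀ i (𝒟.m i θ) ((((1 + ε₀) ^ n)⁻¹)⁻¹ • ζ)) ∞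
      (volume : Measure ℝ³) := by
    rw [hper]
    exact hm
  have htoLp : hmc.toLp _ = hm.toLp _ := MemLp.toLp_congr _ _ (Eventually.of_forall fun ζ => by
    rw [hper])
  rw [𝒟.singleScaleAt_slot hξ hε hε1, 𝒟.singleScaleAt_slot hξ hε hε1, dil_fourierMultiplier hc hm hmc,
    htoLp, dil_rot]

end SingleScaleAt

/-! ### The original datum on truncated fields -/

/-- **The Fourier side of a slot of the dilation-free datum of (3.9) on a truncated field**:
`𝓕(A_{i,ω}(χᵢ(D)U))(ζ) = m_{i,ω}(ζ) χᵢ(ζ) R_ℂ Û(R⁻¹ζ)` a.e. [cite: Tao2016AveragedNS, §3.4 p. 17] -/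
theorem fourierFn_slot_slotCutoffAt (hlam : ∀ i θ, 𝒟.lam i θ = 1) (ξ : Fin 3 → ℝ³) {ε₀ : ℝ}
    (hε : 0 < ε₀) (i : Fin 3) (θ : 𝒟.Ω) (U : L2C) :
    fourierFn (𝒟.slot i θ (fourierMultiplier (slotCutoffAtLp ξ hε i) U)) =ᵐ[volume] fun ζ =>
      (𝒟.m i θ ζ * slotCutoffAt ξ ε₀ i ζ) • rotMat (𝒟.R i θ) (fourierFn U ((𝒟.R i θ).symm ζ)) := by
  have hslot : 𝒟.slot i θ (fourierMultiplier (slotCutoffAtLp ξ hε i) U) =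
      fourierMultiplier (((𝒟.isComplexSymbol i θ).memLp_top).toLp _)
        (rot (𝒟.R i θ) (fourierMultiplier (slotCutoffAtLp ξ hε i) U)) := by
    show fourierMultiplier _ (rot (𝒟.R i θ) (dil (𝒟.lam i θ) _)) = _
    rw [hlam, dil_one]
    rfl
  rw [hslot]
  have hχ : fourierFn (fourierMultiplier (slotCutoffAtLp ξ hε i) U) =ᵐ[volume] fun ζ =>
      slotCutoffAt ξ ε₀ i ζ • fourierFn U ζ :=
    fourierFn_fourierMultiplier_toLp _ U
  filter_upwards [fourierFn_fourierMultiplier_toLp ((𝒟.isComplexSymbol i θ).memLp_top)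
    (rot (𝒟.R i θ) (fourierMultiplier (slotCutoffAtLp ξ hε i) U)),
    fourierFn_rot (𝒟.R i θ) (fourierMultiplier (slotCutoffAtLp ξ hε i) U),
    (𝒟.R i θ).symm.measurePreserving.quasiMeasurePreserving.ae_eq hχ] with ζ h1 h2 h3
  simp only [Function.comp_apply] at h3
  rw [h1, h2, h3, map_smul, smul_smul, slotCutoffAt_linearIsometryEquiv]

/-- **Symbol surgery for `B_{η,ρ,0;ξ}`** (the vanishing of the cross terms, §3.4):
`B_{η,ρ,0;ξ}(A_{1,ω}χ₁(D)U, A_{2,ω}χ₂(D)V, A_{3,ω}χ₃(D)X) = B_{η,ρ,0;ξ}(A'_{1,ω}U, A'_{2,ω}V, A'_{3,ω}X)`: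
the weight confines `ζⱼ` to the shells `| |ζⱼ| - |ξ j| | < 60ε₀²`, on which `m̃ⱼ = mⱼχⱼ`.
[cite: Tao2016AveragedNS, §3.4 p. 17] -/
theorem weightedForm_slot_localiseAt (hlam : ∀ i θ, 𝒟.lam i θ = 1)
    (hξ : ∀ j, 1 / 2 ≤ ‖ξ j‖ ∧ ‖ξ j‖ ≤ 2) {ε₀ : ℝ} (hε : 0 < ε₀) (hε1 : ε₀ ≤ 1 / 1000) (θ : 𝒟.Ω)
    (U V X : L2C) :
    weightedForm (scaleWeightAt ξ ε₀ 0) (𝒟.slot 0 θ (fourierMultiplier (slotCutoffAtLp ξ hε 0) U))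
        (𝒟.slot 1 θ (fourierMultiplier (slotCutoffAtLp ξ hε 1) V))
        (𝒟.slot 2 θ (fourierMultiplier (slotCutoffAtLp ξ hε 2) X)) =
      weightedForm (scaleWeightAt ξ ε₀ 0) ((𝒟.singleScaleAt hξ hε hε1).slot 0 θ U)
        ((𝒟.singleScaleAt hξ hε hε1).slot 1 θ V) ((𝒟.singleScaleAt hξ hε hε1).slot 2 θ X) := by
  have hε10 : ε₀ ≤ 1 / 10 := hε1.trans (by norm_num)
  have hagree : ∀ (i : Fin 3) (Y : L2C), ∀ᵐ ζ ∂(volume : Measure ℝ³),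
      ζ ∈ normShell ‖ξ i‖ (60 * ε₀ ^ 2) →
        fourierFn (𝒟.slot i θ (fourierMultiplier (slotCutoffAtLp ξ hε i) Y)) ζ =
          fourierFn ((𝒟.singleScaleAt hξ hε hε1).slot i θ Y) ζ := by
    intro i Y
    filter_upwards [𝒟.fourierFn_slot_slotCutoffAt hlam ξ hε i θ Y,
      𝒟.fourierFn_singleScaleAt_slot hξ hε hε1 i θ Y] with ζ h1 h2 hζ
    rw [h1, h2, localisedSymbolAt_eq_of_mem_normShell hξ hε hε1 i _ hζ]
  exact weightedForm_congr_on (fun p hp => scaleWeightAt_zero_regions hξ hε hε10 hp)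
    (hagree 0 U) (hagree 1 V) (hagree 2 X)

/-! ### `⟨C_n(u,v), w⟩ = ∫_Ω ⟨B_{η,ρ,n;ξ}(A'_1 u, A'_2 v), A'_3 w⟩ dμ` -/

/-- **The `n`-th cascade term as an `Ω`-average of `B_{η,ρ,n;ξ}` at the single-scale slots**, for
the dilation-free datum `𝒟` realising (3.9) about `ξ`, profiles normalised about `ξ` and
`u, v, w ∈ H¹⁰_df ⊗ ℂ`. [cite: Tao2016AveragedNS, §3.4 p. 17] -/
theorem cascadeTerm_eq_integral_singleScaleAt (hlam : ∀ i θ, 𝒟.lam i θ = 1)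
    (hξ : ∀ j, 1 / 2 ≤ ‖ξ j‖ ∧ ‖ξ j‖ ≤ 2) {ε₀ : ℝ} (hε : 0 < ε₀) (hε1 : ε₀ ≤ 1 / 1000)
    {ψ : Fin 3 → 𝓢(ℝ³, ℂ³)} (hψ : NormalisedProfilesAt ξ ε₀ ψ)
    (h𝒟 : ∀ u v w, MemH10dfC u → MemH10dfC v → MemH10dfC w →
      singleScaleForm (ψ 0) (ψ 1) (ψ 2) u v w = 𝒟.average (betaRhoZeroFormAt ξ ε₀) u v w)
    {u v w : L2C} (hu : MemH10dfC u) (hv : MemH10dfC v) (hw : MemH10dfC w) (n : ℤ) :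
    pairing u (conjL2 (cplxCascadeWavelet ε₀ (ψ 0) n)) *
        pairing v (conjL2 (cplxCascadeWavelet ε₀ (ψ 1) n)) *
        pairing w (conjL2 (cplxCascadeWavelet ε₀ (ψ 2) n)) =
      ∫ θ, betaRhoScaleFormAt ξ ε₀ n ((𝒟.singleScaleAt hξ hε hε1).slot 0 θ u)
        ((𝒟.singleScaleAt hξ hε hε1).slot 1 θ v) ((𝒟.singleScaleAt hξ hε hε1).slot 2 θ w) ∂𝒟.μ := by
  have hq : 0 < 1 + ε₀ := by linarith
  have hc : 0 < ((1 + ε₀) ^ n)⁻¹ := inv_pos.2 (zpow_pos hq n)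
  have hε' : ε₀ ≤ 1 := hε1.trans (by norm_num)
  rw [cascadeTerm_eq_singleScaleForm_dil hq]
  rw [← singleScaleForm_fourierMultiplierAt hψ (fun i => slotCutoffAtLp ξ hε i)
    (fun j => slotCutoffAtLp_eq_one_on_ball hξ hε hε' j)]
  rw [h𝒟 _ _ _ ((hu.dil hc).fourierMultiplier _) ((hv.dil hc).fourierMultiplier _)
    ((hw.dil hc).fourierMultiplier _)]
  unfold average
  refine integral_congr_ae (Eventually.of_forall fun θ => ?_)
  simp only
  rw [betaRhoZeroFormAt_eq_weightedForm ξ, 𝒟.weightedForm_slot_localiseAt hlam hξ hε hε1,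
    ← betaRhoZeroFormAt_eq_weightedForm ξ, 𝒟.singleScaleAt_slot_dil hξ hε hε1,
    𝒟.singleScaleAt_slot_dil hξ hε hε1, 𝒟.singleScaleAt_slot_dil hξ hε hε1,
    ← betaRhoScaleFormAt_eq_dil ξ hq]

/-! ### Summing over the scales -/

/-- **`⟨C(u,v), w⟩ = (1/(-πi)) ∫_Ω ⟨B_{η,ρ;ξ}(m̃₁(D)Rot u, m̃₂(D)Rot v), m̃₃(D)Rot w⟩ dμ`** ("Summing,
we see that …", §3.4), with the factor `1/(-πi)` absorbed into the first symbol: the complexified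
cascade form (3.6) is the complex average of `B_{η,ρ;ξ}` over the scaled single-scale datum about `ξ`.
[cite: Tao2016AveragedNS, §3.4 p. 17] -/
theorem cplxBasicCascadeForm_eq_averageAt (hlam : ∀ i θ, 𝒟.lam i θ = 1)
    (hξ : ∀ j, 1 / 2 ≤ ‖ξ j‖ ∧ ‖ξ j‖ ≤ 2) {ε₀ : ℝ} (hε : 0 < ε₀) (hε1 : ε₀ ≤ 1 / 1000)
    {ψ : Fin 3 → 𝓢(ℝ³, ℂ³)} (hψ : NormalisedProfilesAt ξ ε₀ ψ)
    (h𝒟 : ∀ u v w, MemH10dfC u → MemH10dfC v → MemH10dfC w →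
      singleScaleForm (ψ 0) (ψ 1) (ψ 2) u v w = 𝒟.average (betaRhoZeroFormAt ξ ε₀) u v w)
    {u v w : L2C} (hu : MemH10dfC u) (hv : MemH10dfC v) (hw : MemH10dfC w) :
    cplxBasicCascadeForm ε₀ (ψ 0) (ψ 1) (ψ 2) u v w =
      ((𝒟.singleScaleAt hξ hε hε1).scale (-(Real.pi * Complex.I))⁻¹).average
        (betaRhoFormAt ξ ε₀) u v w := by
  have hε10 : ε₀ ≤ 1 / 10 := hε1.trans (by norm_num)
  set 𝒟' := 𝒟.singleScaleAt hξ hε hε1 with h𝒟'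
  have hπ : -(Real.pi * Complex.I) ≠ 0 :=
    neg_ne_zero.2 (mul_ne_zero (Complex.ofReal_ne_zero.2 Real.pi_ne_zero) Complex.I_ne_zero)
  -- Step 1: each scale as an `Ω`-integral of the weighted form
  have hterm : ∀ n : ℤ, (((1 + ε₀) ^ ((5 : ℝ) * (n : ℝ) / 2) : ℝ) : ℂ) *
      (pairing u (conjL2 (cplxCascadeWavelet ε₀ (ψ 0) n)) *
        pairing v (conjL2 (cplxCascadeWavelet ε₀ (ψ 1) n)) *
        pairing w (conjL2 (cplxCascadeWavelet ε₀ (ψ 2) n))) =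
      ∫ θ, weightedForm (scaleWeightAt ξ ε₀ n) (𝒟'.slot 0 θ u) (𝒟'.slot 1 θ v) (𝒟'.slot 2 θ w)
        ∂𝒟'.μ := by
    intro n
    rw [𝒟.cascadeTerm_eq_integral_singleScaleAt hlam hξ hε hε1 hψ h𝒟 hu hv hw n,
      ← integral_const_mul]
    refine integral_congr_ae (Eventually.of_forall fun θ => ?_)
    simp only
    rw [betaRhoScaleFormAt_eq_weightedForm ξ, ← mul_assoc, cascade_prefactor_mul hε, one_mul]
  -- Step 2: exchange the sum over scales with the `Ω`-integral
  have hF : ∀ n : ℤ, AEStronglyMeasurable (fun θ => weightedForm (scaleWeightAt ξ ε₀ n)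
      (𝒟'.slot 0 θ u) (𝒟'.slot 1 θ v) (𝒟'.slot 2 θ w)) 𝒟'.μ := fun n =>
    𝒟'.aestronglyMeasurable_weightedForm_slot (measurable_scaleWeightAt ξ ε₀ n) u v w
  have hF' : ∑' n : ℤ, ∫⁻ θ, ‖weightedForm (scaleWeightAt ξ ε₀ n) (𝒟'.slot 0 θ u) (𝒟'.slot 1 θ v)
      (𝒟'.slot 2 θ w)‖ₑ ∂𝒟'.μ ≠ ∞ :=
    ne_of_lt (𝒟'.tsum_lintegral_enorm_weightedForm_slot_lt_top (measurable_scaleWeightAt ξ ε₀)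
      (tsum_enorm_scaleWeightAt_le_one hξ hε hε10) w hu.1 hv.1)
  unfold cplxBasicCascadeForm
  simp_rw [hterm]
  rw [← integral_tsum hF hF']
  -- Step 3: resum the scales inside and absorb the factor `1/(-πi)`
  unfold average
  refine integral_congr_ae (Eventually.of_forall fun θ => ?_)
  simp only
  have hint : Integrable (eulerIntegrand (𝒟'.slot 0 θ u) (𝒟'.slot 1 θ v) (𝒟'.slot 2 θ w)) :=
    𝒟'.integrable_eulerIntegrand_slot w θ hu.1 hv.1
  rw [← weightedForm_tsum (measurable_scaleWeightAt ξ ε₀) (tsum_enorm_scaleWeightAt_le_one hξ hε hε10)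
      hint,
    show (fun p : ℝ³ × ℝ³ => ∑' n : ℤ, scaleWeightAt ξ ε₀ n p) = rhoWeightAt ξ ε₀ from
      funext fun p => (rhoWeightAt_eq_tsum ξ ε₀ p).symm,
    𝒟'.scale_slot_zero, 𝒟'.scale_slot_of_ne_zero _ (show (1 : Fin 3) ≠ 0 by decide),
    𝒟'.scale_slot_of_ne_zero _ (show (2 : Fin 3) ≠ 0 by decide), betaRhoFormAt_smul₁ ξ,
    betaRhoFormAt_eq_weightedForm ξ, ← mul_assoc, inv_mul_cancel₀ hπ, one_mul]

end ComplexAveragingDatum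

/-! ### The dilation-free §3.4 about `ξ` -/

/-- **Tao 2016, §3.4 at an arbitrary base triple, dilation-free**: for `0 < ε₀ ≤ 1/1000`, base moduli
`‖ξ j‖ ∈ [1/2, 2]` and profiles normalised about `ξ` (`ψ̂ⱼ ⊆ B(ξ j, ε₀³)`), if the single-scale piece
`C₀` (3.8) is a DILATION-FREE complex average of `B_{η,ρ,0;ξ}` then the complexified basic cascade
operator `C` (3.6) is a DILATION-FREE complex average of `B_{η,ρ;ξ}` (the datum
`(𝒟.singleScaleAt …).scale (-πi)⁻¹` has `λ ≡ 1`). [cite: Tao2016AveragedNS, §3.4 pp. 16–17 and Remark 3.5 p. 20] -/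
theorem cascade_of_singleScaleAt_noDil (hξ : ∀ j, 1 / 2 ≤ ‖ξ j‖ ∧ ‖ξ j‖ ≤ 2) {ε₀ : ℝ} (hε : 0 < ε₀)
    (hε1 : ε₀ ≤ 1 / 1000) {ψ : Fin 3 → 𝓢(ℝ³, ℂ³)} (hψ : NormalisedProfilesAt ξ ε₀ ψ)
    (hC₀ : IsComplexAverageNoDilOf (singleScaleForm (ψ 0) (ψ 1) (ψ 2)) (betaRhoZeroFormAt ξ ε₀)) :
    IsComplexAverageNoDilOf (cplxBasicCascadeForm ε₀ (ψ 0) (ψ 1) (ψ 2)) (betaRhoFormAt ξ ε₀) := by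
  obtain ⟨𝒟, hlam, h𝒟⟩ := hC₀
  exact ⟨(𝒟.singleScaleAt hξ hε hε1).scale (-(Real.pi * Complex.I))⁻¹, fun _ _ => rfl,
    fun u v w hu hv hw => 𝒟.cplxBasicCascadeForm_eq_averageAt hlam hξ hε hε1 hψ h𝒟 hu hv hw⟩

end Literature.Analysis.FluidPDE.Tao2016
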